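import Mathlib
import HarnessLib
import Summits.HubbardSuperconductivity.HubbardSuperconductivity.Theorems.KLProgrammeKLRegimeTwoVolumeLipBaseOfGrid

/-!
# Route `KLProgramme` — crux K3 ENGINE (stmt-HubbardSuperconductivity-20437), stub (e) proof-input «(e)-D-ROWS»: THE (Dμ) ROW WITH BLOCK-DEPENDENT JUMP ROWS
# (seat hubbard-kl-k3c4-p1 g25, VL lane; `--supports` 20437; DROWS-SCOPE-g25 §13 item 4)

The (Dμ) rows of the tree (`…LipRemeasureSup.klLipInputDiffSup_le_remeasured` p709178, `…LipBaseRemeasure.…_of_base` p711315, `…LipBaseOfGrid.…_of_grid` p720574)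
bound the `klScaleWt`-weighted row / column sums of EVERY jump matrix `klJump (bL) (dk−1) (dk′)`, `k′ < k`, by one constant `cW`.  The column sums grow with the
jump (a coarse sector of `F_{dk′}` meets `≍ 2^{dk−1−dk′}` fine sectors of `F_{dk−1}`), and the units bookkeeping of the bridge
(`…EngineTowerLipschitzBridgeGeom.hprofd_of_remeasured_geom`) needs the growth per block explicitly; so the three rows are re-issued with a row bound `cW k′` per
earlier block (and `cW₀` for the base jump `klJump (bL) (dk−1) 0`).  Proofs = the originals' compositions, summand by summand.

* `klLipInputDiffSup_le_remeasured_var`, `klLipInputDiffSup_le_remeasured_of_base_var`, **`klLipInputDiffSup_le_remeasured_of_grid_var`**.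

Compositions of landed theorems; nothing asserts the (D) rows, stub (e), VL, K3 or superconductivity.
References: BGM 2006 §2.7 (2.71), §2.8, §3 [cite: BenfattoGiulianiMastropietro2006]; Salmhofer 1998 §4.
-/

noncomputable section

namespace Summit.HubbardSuperconductivity.HubbardSuperconductivity.Theorems.TwoVolumeLip

set_option linter.dupNamespace false -- summit = problem name (single-conjunct summit), D-0017

open Finset Literature.MathematicalPhysics.QuantumLattice GrassmannAlgebra Literature.Probability.LatticeModels
open Literature.MathematicalPhysics.QuantumLattice.FermiRG
open Summit.HubbardSuperconductivity.HubbardSuperconductivity.Theorems.KLRegimeSplit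
open Summit.HubbardSuperconductivity.HubbardSuperconductivity.Theorems.KLProgrammeLegKernels
open Summit.HubbardSuperconductivity.HubbardSuperconductivity.Theorems.DispersionFlow
open Summit.HubbardSuperconductivity.HubbardSuperconductivity.Theorems.EngineV8
open Summit.HubbardSuperconductivity.HubbardSuperconductivity.Theorems.TwoVolumeSource
open Summit.HubbardSuperconductivity.HubbardSuperconductivity.Theorems.TwoVolumeDefect

variable {L b M : ℕ} [NeZero L] [NeZero (b * L)] [NeZero M]

/-- **The (Dμ) row in absolute units with BLOCK-DEPENDENT jump rows** — `…LipRemeasureSup.klLipInputDiffSup_le_remeasured` verbatim except that the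
`klScaleWt (bL) M β j_r`-weighted row / column sums of the jump matrix `klJump (bL) (dk−1) (dk′)` of the earlier block `k′` are bounded by `cW k′` (the sums grow with
the jump `dk−1−dk′`), so the summand of block `k′` carries `(cW k′)^{n+1}`. -/
theorem klLipInputDiffSup_le_remeasured_var {β : ℝ} (hβ : 0 < β) (U μ : ℝ) (K : TrigPolyC4v) {d : ℕ} (hd : 2 ≤ d) (k n D₀ r jr : ℕ) (hD₀ : 2 * r ≤ D₀)
    {ΛT : ℝ} {cW : ℕ → ℝ} (hΛT : 0 ≤ ΛT) (hΛr : ΛT ≤ klScale klE0 jr) (hcW : ∀ k', 0 ≤ cW k')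
    (hrow : ∀ k' ∈ range k, ∀ x, ∑ y', ‖klJump (b * L) M β μ K (d * k - 1) (d * k') x y'‖ *
      klScaleWt (b * L) M β jr {latticeLegPos (2 * (2 * M)) x, latticeLegPos (2 * (2 * M)) y'} ≤ cW k')
    (hcol : ∀ k' ∈ range k, ∀ y', ∑ x, ‖klJump (b * L) M β μ K (d * k - 1) (d * k') x y'‖ *
      klScaleWt (b * L) M β jr {latticeLegPos (2 * (2 * M)) x, latticeLegPos (2 * (2 * M)) y'} ≤ cW k')
    {B₀ : ℝ} (hB₀ : 0 ≤ B₀)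
    (hbase : ∀ (q : Fin (n + 1)) (w : SpaceTimeIdx (b * L) M × SectorLeg (sectorCount (d * k - 1))), w ∈ klDeepPins L (D₀ + r) →
      ∑ X ∈ univ.filter (fun X : Fin (n + 1) → SpaceTimeIdx (b * L) M × SectorLeg (sectorCount (d * k - 1)) => X q = w),
        ‖kernel ℂ (sectorPreimage β (klAnisoFamily (b * L) M β μ K klE0 (d * k - 1)) (klEffectiveAction (b * L) M β U μ K klE0 0) -
            klGlue L b M (sectorCount (d * k - 1))
              (sectorPreimage β (klAnisoFamily L M β μ K klE0 (d * k - 1)) (klEffectiveAction L M β U μ K klE0 0))) (n + 1) X‖ ≤ B₀)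
    {N Nfar : ℕ → ℝ} (hN0 : ∀ k', 0 ≤ N k') (hNfar0 : ∀ k', 0 ≤ Nfar k')
    (hN : ∀ k' ∈ range k, ∀ (q : Fin (n + 1)) (y : SpaceTimeIdx L M × SectorLeg (sectorCount (d * k'))),
      ∑ Y ∈ univ.filter (fun Y : Fin (n + 1) → SpaceTimeIdx L M × SectorLeg (sectorCount (d * k')) => Y q = y),
        ‖kernel ℂ (klLipBorn L M β U μ K d k') (n + 1) Y‖ ≤ N k')
    (hNfar : ∀ k' ∈ range k, ∀ (q : Fin (n + 1)) (y : SpaceTimeIdx L M × SectorLeg (sectorCount (d * k'))) (i : Fin (n + 1)),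
      ∑ Y ∈ univ.filter (fun Y : Fin (n + 1) → SpaceTimeIdx L M × SectorLeg (sectorCount (d * k')) =>
          Y q = y ∧ r < Torus.tnorm ((Y q).1.2 - (Y i).1.2)), ‖kernel ℂ (klLipBorn L M β U μ K d k') (n + 1) Y‖ ≤ Nfar k') :
    klLipInputDiffSup L b M β U μ K d k (n + 1) (D₀ + r) ≤
      B₀ + ∑ k' ∈ range k,
        (cW k' ^ n * (cW k' * klLipBornDiffSup L b M β U μ K d k' (n + 1) D₀ +
            cW k' / (1 + ΛT * ((r : ℝ) + 1)) * klLipBornDiffSup L b M β U μ K d k' (n + 1) 0) +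
          (2 * cW k' ^ n * (cW k' / (1 + ΛT * ((r : ℝ) + 1))) * N k' +
            n * cW k' ^ n * (5 * (cW k' / (1 + ΛT * ((r : ℝ) + 1))) * N k' + 2 * cW k' * Nfar k'))) := by
  have hBD0 : ∀ k' R, 0 ≤ klLipBornDiffSup L b M β U μ K d k' (n + 1) R := fun k' R => klLipBornDiffSup_nonneg β U μ K d k' (n + 1) R
  refine klLipInputDiffSup_le_of_forall β U μ K d k (n + 1) (D₀ + r) (add_nonneg hB₀ (sum_nonneg fun k' _ => ?_)) fun q w hw => ?_
  · have h1 := hBD0 k' D₀; have h2 := hBD0 k' 0; have h3 := hN0 k'; have h4 := hNfar0 k'; have h5 := hcW k'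
    positivity
  · have hw' : ∀ j, D₀ + r ≤ (w.1.2 j).val % L ∧ (w.1.2 j).val % L + (D₀ + r) < L := mem_klDeepPins.1 hw
    refine sum_pinned_norm_kernel_klLipInputDiff_le_of_parts hβ.ne' U μ K hd k q w (hbase q w hw) fun k' hk' => ?_
    exact lipRemeasureSummand_le_of_scaleWtRows hβ U μ K d k k' jr hΛT hΛr (hcW k') (hrow k' hk') (hcol k' hk') q w D₀ r hD₀ hw' (hN0 k') (hNfar0 k')
      (hBD0 k' D₀) (hBD0 k' 0) (hN k' hk' q) (hNfar k' hk' q) (fun y' hy' => sum_pinned_norm_kernel_bornDiff_le_sup_of_near β U μ K d k' q hw' y' hy')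
      (fun y' => sum_pinned_norm_kernel_bornDiff_le_sup_zero β U μ K d k' q y')

/-- **The (Dμ) row with the base discharged, block-dependent jump rows** — `…LipBaseRemeasure.klLipInputDiffSup_le_remeasured_of_base` verbatim with the rows of the
base jump `klJump (bL) (dk−1) 0` bounded by `cW₀` and those of the jump of block `k′` by `cW k′`. -/
theorem klLipInputDiffSup_le_remeasured_of_base_var {β : ℝ} (hβ : 0 < β) (U μ : ℝ) (K : TrigPolyC4v) {d : ℕ} (hd : 2 ≤ d) {k : ℕ} (hk : 1 ≤ k) (n D₀ r jr : ℕ)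
    (hD₀ : 2 * r ≤ D₀) {ΛT : ℝ} {cW : ℕ → ℝ} {cW₀ : ℝ} (hΛT : 0 ≤ ΛT) (hΛr : ΛT ≤ klScale klE0 jr) (hcW : ∀ k', 0 ≤ cW k') (hcW₀ : 0 ≤ cW₀)
    (hrow : ∀ k' ∈ range k, ∀ x, ∑ y', ‖klJump (b * L) M β μ K (d * k - 1) (d * k') x y'‖ *
      klScaleWt (b * L) M β jr {latticeLegPos (2 * (2 * M)) x, latticeLegPos (2 * (2 * M)) y'} ≤ cW k')
    (hcol : ∀ k' ∈ range k, ∀ y', ∑ x, ‖klJump (b * L) M β μ K (d * k - 1) (d * k') x y'‖ *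
      klScaleWt (b * L) M β jr {latticeLegPos (2 * (2 * M)) x, latticeLegPos (2 * (2 * M)) y'} ≤ cW k')
    (hrow0 : ∀ x, ∑ y', ‖klJump (b * L) M β μ K (d * k - 1) 0 x y'‖ *
      klScaleWt (b * L) M β jr {latticeLegPos (2 * (2 * M)) x, latticeLegPos (2 * (2 * M)) y'} ≤ cW₀)
    (hcol0 : ∀ y', ∑ x, ‖klJump (b * L) M β μ K (d * k - 1) 0 x y'‖ *
      klScaleWt (b * L) M β jr {latticeLegPos (2 * (2 * M)) x, latticeLegPos (2 * (2 * M)) y'} ≤ cW₀)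
    {Nb Nbfar Eb NDb : ℝ} (hNb0 : 0 ≤ Nb) (hNbfar0 : 0 ≤ Nbfar) (hEb0 : 0 ≤ Eb) (hNDb0 : 0 ≤ NDb)
    (hNb : ∀ (q : Fin (n + 1)) y, ∑ Y ∈ univ.filter (fun Y : Fin (n + 1) → SpaceTimeIdx L M × SectorLeg (sectorCount 0) => Y q = y),
      ‖kernel ℂ (sectorPreimage β (klAnisoFamily L M β μ K klE0 0) (klEffectiveAction L M β U μ K klE0 0)) (n + 1) Y‖ ≤ Nb)
    (hNbfar : ∀ (q : Fin (n + 1)) y (i : Fin (n + 1)),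
      ∑ Y ∈ univ.filter (fun Y : Fin (n + 1) → SpaceTimeIdx L M × SectorLeg (sectorCount 0) => Y q = y ∧ r < Torus.tnorm ((Y q).1.2 - (Y i).1.2)),
        ‖kernel ℂ (sectorPreimage β (klAnisoFamily L M β μ K klE0 0) (klEffectiveAction L M β U μ K klE0 0)) (n + 1) Y‖ ≤ Nbfar)
    (hEb : ∀ (q : Fin (n + 1)) (y' : SpaceTimeIdx (b * L) M × SectorLeg (sectorCount 0)), y' ∈ klDeepPins L D₀ →
      ∑ Y' ∈ univ.filter (fun Y' : Fin (n + 1) → SpaceTimeIdx (b * L) M × SectorLeg (sectorCount 0) => Y' q = y'),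
        ‖kernel ℂ (sectorPreimage β (klAnisoFamily (b * L) M β μ K klE0 0) (klEffectiveAction (b * L) M β U μ K klE0 0) -
            klGlue L b M (sectorCount 0) (sectorPreimage β (klAnisoFamily L M β μ K klE0 0) (klEffectiveAction L M β U μ K klE0 0))) (n + 1) Y'‖ ≤ Eb)
    (hNDb : ∀ (q : Fin (n + 1)) y', ∑ Y' ∈ univ.filter (fun Y' : Fin (n + 1) → SpaceTimeIdx (b * L) M × SectorLeg (sectorCount 0) => Y' q = y'),
        ‖kernel ℂ (sectorPreimage β (klAnisoFamily (b * L) M β μ K klE0 0) (klEffectiveAction (b * L) M β U μ K klE0 0) -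
            klGlue L b M (sectorCount 0) (sectorPreimage β (klAnisoFamily L M β μ K klE0 0) (klEffectiveAction L M β U μ K klE0 0))) (n + 1) Y'‖ ≤ NDb)
    {N Nfar : ℕ → ℝ} (hN0 : ∀ k', 0 ≤ N k') (hNfar0 : ∀ k', 0 ≤ Nfar k')
    (hN : ∀ k' ∈ range k, ∀ (q : Fin (n + 1)) (y : SpaceTimeIdx L M × SectorLeg (sectorCount (d * k'))),
      ∑ Y ∈ univ.filter (fun Y : Fin (n + 1) → SpaceTimeIdx L M × SectorLeg (sectorCount (d * k')) => Y q = y),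
        ‖kernel ℂ (klLipBorn L M β U μ K d k') (n + 1) Y‖ ≤ N k')
    (hNfar : ∀ k' ∈ range k, ∀ (q : Fin (n + 1)) (y : SpaceTimeIdx L M × SectorLeg (sectorCount (d * k'))) (i : Fin (n + 1)),
      ∑ Y ∈ univ.filter (fun Y : Fin (n + 1) → SpaceTimeIdx L M × SectorLeg (sectorCount (d * k')) =>
          Y q = y ∧ r < Torus.tnorm ((Y q).1.2 - (Y i).1.2)), ‖kernel ℂ (klLipBorn L M β U μ K d k') (n + 1) Y‖ ≤ Nfar k') :
    klLipInputDiffSup L b M β U μ K d k (n + 1) (D₀ + r) ≤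
      (cW₀ ^ n * (cW₀ * Eb + cW₀ / (1 + ΛT * ((r : ℝ) + 1)) * NDb) +
          (2 * cW₀ ^ n * (cW₀ / (1 + ΛT * ((r : ℝ) + 1))) * Nb + n * cW₀ ^ n * (5 * (cW₀ / (1 + ΛT * ((r : ℝ) + 1))) * Nb + 2 * cW₀ * Nbfar))) +
        ∑ k' ∈ range k,
          (cW k' ^ n * (cW k' * klLipBornDiffSup L b M β U μ K d k' (n + 1) D₀ +
              cW k' / (1 + ΛT * ((r : ℝ) + 1)) * klLipBornDiffSup L b M β U μ K d k' (n + 1) 0) +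
            (2 * cW k' ^ n * (cW k' / (1 + ΛT * ((r : ℝ) + 1))) * N k' +
              n * cW k' ^ n * (5 * (cW k' / (1 + ΛT * ((r : ℝ) + 1))) * N k' + 2 * cW k' * Nfar k'))) := by
  have hdk : 2 ≤ d * k := le_trans (by omega) (Nat.mul_le_mul hd hk)
  have hτ : 0 ≤ cW₀ / (1 + ΛT * ((r : ℝ) + 1)) := by positivity
  refine klLipInputDiffSup_le_remeasured_var hβ U μ K hd k n D₀ r jr hD₀ hΛT hΛr hcW hrow hcol (by positivity) (fun q w hw => ?_) hN0 hNfar0 hN hNfar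
  have hw' : ∀ j, D₀ + r ≤ (w.1.2 j).val % L ∧ (w.1.2 j).val % L + (D₀ + r) < L := mem_klDeepPins.1 hw
  exact lipBase_le_of_scaleWtRows hβ U μ K hdk jr hΛT hΛr hcW₀ hrow0 hcol0 q w D₀ r hD₀ hw' hNb0 hNbfar0 hEb0 hNDb0 (hNb q) (hNbfar q)
    (fun y' hy' => hEb q y' (mem_klDeepPins_of_tnorm_le hw' hy')) (hNDb q)

/-- **The (Dμ) row with the base discharged to GRID data, block-dependent jump rows** — `…LipBaseOfGrid.klLipInputDiffSup_le_remeasured_of_grid` verbatim with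
`cW₀` (base jump) and `cW k′` (jump of block `k′`). -/
theorem klLipInputDiffSup_le_remeasured_of_grid_var {β : ℝ} (hβ : 0 < β) (U μ : ℝ) (K : TrigPolyC4v) {d : ℕ} (hd : 2 ≤ d) {k : ℕ} (hk : 1 ≤ k) (n D₀g rg r jr : ℕ) (hD₀g : 2 * rg ≤ D₀g)
    (hD₀ : 2 * r ≤ D₀g + rg) {ΛT : ℝ} {cW : ℕ → ℝ} {cW₀ : ℝ} (hΛT : 0 ≤ ΛT) (hΛr : ΛT ≤ klScale klE0 jr) (hcW : ∀ k', 0 ≤ cW k') (hcW₀ : 0 ≤ cW₀)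
    (hrow : ∀ k' ∈ range k, ∀ x, ∑ y', ‖klJump (b * L) M β μ K (d * k - 1) (d * k') x y'‖ *
      klScaleWt (b * L) M β jr {latticeLegPos (2 * (2 * M)) x, latticeLegPos (2 * (2 * M)) y'} ≤ cW k')
    (hcol : ∀ k' ∈ range k, ∀ y', ∑ x, ‖klJump (b * L) M β μ K (d * k - 1) (d * k') x y'‖ *
      klScaleWt (b * L) M β jr {latticeLegPos (2 * (2 * M)) x, latticeLegPos (2 * (2 * M)) y'} ≤ cW k')
    (hrow0 : ∀ x, ∑ y', ‖klJump (b * L) M β μ K (d * k - 1) 0 x y'‖ *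
      klScaleWt (b * L) M β jr {latticeLegPos (2 * (2 * M)) x, latticeLegPos (2 * (2 * M)) y'} ≤ cW₀)
    (hcol0 : ∀ y', ∑ x, ‖klJump (b * L) M β μ K (d * k - 1) 0 x y'‖ *
      klScaleWt (b * L) M β jr {latticeLegPos (2 * (2 * M)) x, latticeLegPos (2 * (2 * M)) y'} ≤ cW₀)
    {Nb Nbfar Nb' : ℝ} (hNb0 : 0 ≤ Nb) (hNbfar0 : 0 ≤ Nbfar) (hNb'0 : 0 ≤ Nb')
    (hNb : ∀ (q : Fin (n + 1)) y, ∑ Y ∈ univ.filter (fun Y : Fin (n + 1) → SpaceTimeIdx L M × SectorLeg (sectorCount 0) => Y q = y),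
      ‖kernel ℂ (sectorPreimage β (klAnisoFamily L M β μ K klE0 0) (klEffectiveAction L M β U μ K klE0 0)) (n + 1) Y‖ ≤ Nb)
    (hNbfar : ∀ (q : Fin (n + 1)) y (i : Fin (n + 1)),
      ∑ Y ∈ univ.filter (fun Y : Fin (n + 1) → SpaceTimeIdx L M × SectorLeg (sectorCount 0) => Y q = y ∧ r < Torus.tnorm ((Y q).1.2 - (Y i).1.2)),
        ‖kernel ℂ (sectorPreimage β (klAnisoFamily L M β μ K klE0 0) (klEffectiveAction L M β U μ K klE0 0)) (n + 1) Y‖ ≤ Nbfar)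
    (hNb' : ∀ (q : Fin (n + 1)) y', ∑ Y' ∈ univ.filter (fun Y' : Fin (n + 1) → SpaceTimeIdx (b * L) M × SectorLeg (sectorCount 0) => Y' q = y'),
      ‖kernel ℂ (sectorPreimage β (klAnisoFamily (b * L) M β μ K klE0 0) (klEffectiveAction (b * L) M β U μ K klE0 0)) (n + 1) Y'‖ ≤ Nb')
    -- G-4: the grid → sector transfer of the fine volume (weighted rows at `Λ_T′`, block covariance) and the grid data
    {ΛT' cW' : ℝ} (hΛT' : 0 ≤ ΛT') (hcW' : 0 ≤ cW')
    (hrowT : ∀ x, ∑ y', ‖klLipBaseTransfer (b * L) M β μ K x y'‖ * (1 + ΛT' * (Torus.tnorm (x.1.2 - y'.1.1.2) : ℝ)) ≤ cW')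
    (hcolT : ∀ y', ∑ x, ‖klLipBaseTransfer (b * L) M β μ K x y'‖ * (1 + ΛT' * (Torus.tnorm (x.1.2 - y'.1.1.2) : ℝ)) ≤ cW')
    (hcov : ∀ (δ B' B : Fin 2 → Fin b) (xbar : SpaceTimeIdx L M × SectorLeg (sectorCount 0)) (y : GridLeg (GridPoint L (klGridN M))),
      ‖klLipBaseTransfer (b * L) M β μ K ((klBlockEquiv L b M (sectorCount 0)).symm (B' + δ, xbar)) ((klGridBlockEquiv L b M).symm (B + δ, y))‖ =
        ‖klLipBaseTransfer (b * L) M β μ K ((klBlockEquiv L b M (sectorCount 0)).symm (B', xbar)) ((klGridBlockEquiv L b M).symm (B, y))‖)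
    {Ng Ngfar Eg NDg : ℝ} (hNg0 : 0 ≤ Ng) (hNgfar0 : 0 ≤ Ngfar) (hEg0 : 0 ≤ Eg) (hNDg0 : 0 ≤ NDg)
    (hNg : ∀ (q : Fin (n + 1)) y, ∑ Y ∈ univ.filter (fun Y : Fin (n + 1) → GridLeg (GridPoint L (klGridN M)) => Y q = y),
      ‖kernel ℂ (klGridActionZero L M β U μ K) (n + 1) Y‖ ≤ Ng)
    (hNgfar : ∀ (q : Fin (n + 1)) y (i : Fin (n + 1)),
      ∑ Y ∈ univ.filter (fun Y : Fin (n + 1) → GridLeg (GridPoint L (klGridN M)) => Y q = y ∧ rg < Torus.tnorm ((Y q).1.1.2 - (Y i).1.1.2)),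
        ‖kernel ℂ (klGridActionZero L M β U μ K) (n + 1) Y‖ ≤ Ngfar)
    (hEg : ∀ (q : Fin (n + 1)) (y' : GridLeg (GridPoint (b * L) (klGridN M))), (∀ j, D₀g ≤ (y'.1.1.2 j).val % L ∧ (y'.1.1.2 j).val % L + D₀g < L) →
      ∑ Y' ∈ univ.filter (fun Y' : Fin (n + 1) → GridLeg (GridPoint (b * L) (klGridN M)) => Y' q = y'),
        ‖kernel ℂ (klGridActionZero (b * L) M β U μ K - klGridGlue L b M (klGridActionZero L M β U μ K)) (n + 1) Y'‖ ≤ Eg)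
    (hNDg : ∀ (q : Fin (n + 1)) y', ∑ Y' ∈ univ.filter (fun Y' : Fin (n + 1) → GridLeg (GridPoint (b * L) (klGridN M)) => Y' q = y'),
        ‖kernel ℂ (klGridActionZero (b * L) M β U μ K - klGridGlue L b M (klGridActionZero L M β U μ K)) (n + 1) Y'‖ ≤ NDg)
    {N Nfar : ℕ → ℝ} (hN0 : ∀ k', 0 ≤ N k') (hNfar0 : ∀ k', 0 ≤ Nfar k')
    (hN : ∀ k' ∈ range k, ∀ (q : Fin (n + 1)) (y : SpaceTimeIdx L M × SectorLeg (sectorCount (d * k'))),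
      ∑ Y ∈ univ.filter (fun Y : Fin (n + 1) → SpaceTimeIdx L M × SectorLeg (sectorCount (d * k')) => Y q = y),
        ‖kernel ℂ (klLipBorn L M β U μ K d k') (n + 1) Y‖ ≤ N k')
    (hNfar : ∀ k' ∈ range k, ∀ (q : Fin (n + 1)) (y : SpaceTimeIdx L M × SectorLeg (sectorCount (d * k'))) (i : Fin (n + 1)),
      ∑ Y ∈ univ.filter (fun Y : Fin (n + 1) → SpaceTimeIdx L M × SectorLeg (sectorCount (d * k')) =>
          Y q = y ∧ r < Torus.tnorm ((Y q).1.2 - (Y i).1.2)), ‖kernel ℂ (klLipBorn L M β U μ K d k') (n + 1) Y‖ ≤ Nfar k') :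
    klLipInputDiffSup L b M β U μ K d k (n + 1) (D₀g + rg + r) ≤
      (cW₀ ^ n * (cW₀ * (cW' ^ n * (cW' * Eg + cW' / (1 + ΛT' * ((rg : ℝ) + 1)) * NDg) + (2 * cW' ^ n * (cW' / (1 + ΛT' * ((rg : ℝ) + 1))) * Ng + n * cW' ^ n * (5 * (cW' / (1 + ΛT' * ((rg : ℝ) + 1))) * Ng + 2 * cW' * Ngfar))) + cW₀ / (1 + ΛT * ((r : ℝ) + 1)) * (Nb' + Nb)) +
          (2 * cW₀ ^ n * (cW₀ / (1 + ΛT * ((r : ℝ) + 1))) * Nb + n * cW₀ ^ n * (5 * (cW₀ / (1 + ΛT * ((r : ℝ) + 1))) * Nb + 2 * cW₀ * Nbfar))) +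
        ∑ k' ∈ range k,
          (cW k' ^ n * (cW k' * klLipBornDiffSup L b M β U μ K d k' (n + 1) (D₀g + rg) +
              cW k' / (1 + ΛT * ((r : ℝ) + 1)) * klLipBornDiffSup L b M β U μ K d k' (n + 1) 0) +
            (2 * cW k' ^ n * (cW k' / (1 + ΛT * ((r : ℝ) + 1))) * N k' +
              n * cW k' ^ n * (5 * (cW k' / (1 + ΛT * ((r : ℝ) + 1))) * N k' + 2 * cW k' * Nfar k'))) := by
  have hτ' : 0 ≤ cW' / (1 + ΛT' * ((rg : ℝ) + 1)) := by positivity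
  refine klLipInputDiffSup_le_remeasured_of_base_var hβ U μ K hd hk n (D₀g + rg) r jr hD₀ hΛT hΛr hcW hcW₀ hrow hcol hrow0 hcol0 hNb0 hNbfar0
    (by positivity) (by positivity) hNb hNbfar (fun q y' hy' => ?_) (fun q y' => lipBaseDiff_pinned_le_crude β U μ K q (hNb q) (hNb' q) y') hN0 hNfar0 hN hNfar
  have hw' : ∀ j, D₀g + rg ≤ (y'.1.2 j).val % L ∧ (y'.1.2 j).val % L + (D₀g + rg) < L := mem_klDeepPins.1 hy'
  exact lipBaseDiff_pinned_le hβ U μ K hΛT' hcW' hrowT hcolT hcov q y' D₀g rg hD₀g hw' hNg0 hNgfar0 hEg0 hNDg0 (hNg q) (hNgfar q)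
    (fun y'' hy'' => hEg q y'' (gridDeep_of_tnorm_le hw' hy'')) (hNDg q)

end Summit.HubbardSuperconductivity.HubbardSuperconductivity.Theorems.TwoVolumeLip

end
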